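import Literature.AlgebraicGeometry.ModuliOfSheaves.KummerModuliRestrictionInvariants
import Literature.AlgebraicGeometry.ModuliOfSheaves.SheafModuliCohomologyGenerators
import Literature.AlgebraicGeometry.Hyperkaehler.LLVGenerationTransport
import Literature.AlgebraicGeometry.HodgeTheory.ComplexGysin
import Summits.HodgeConjecture.HodgeConjecture.Theorems.OpenQuestionsKummerModuliSpaces
import Summits.Ventures.HodgeKum4.Theorems.KummerFixedLocusDominatedClasses
import Mathlib.RepresentationTheory.Invariants
import HarnessLib
import HarnessLib.Audit

/-!
# KummerModuliInvariantsByMarkmanOnM — the `Γ(K)`-INVARIANT subring of `H*(K_H(v); ℂ)` is generated by the restricted Künneth factors of `ch(ℰ)` (Markman's theorem ON `M_H(v)`) and is dominated by the powers of the abelian surface (Bülles' theorem ON `M_H(v)`) — kernel theorems from named facts; nothing asserted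

Summit `HodgeConjecture/HodgeConjecture`; seat `vhodge-19149-w3` (WIDTH-LEVER second unit on
stmt-HodgeConjecture-19149, director-hodge g7 ∕ g8): the crux idea `kummer-moduli-invariants-by-markman-on-m`
(`Cruxes/NonsplitSixfoldCells/Ideas/kummer-moduli-invariants-by-markman-on-m.md`; authors hodge-lit-oqh-1 g8,
vhodge-oqh-3 g0–g3, hodge-lit-oqh-2 g6) made kernel, invariant half.  FILING ANCHOR: the file is landed
`--supports stmt-HodgeConjecture-19149` (`Theses.SplitImpliesAll.NonsplitSixfoldCells`) on the director's
instruction; its MATHEMATICAL TARGET is the typed `K_H(v)` rung `Theorems.HC_KummerSheafModuliSpace` ∕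
`Theorems.KummerSheafModuliSpace_dominatedByAbelianSurface` (`Theorems/OpenQuestionsKummerModuliSpaces.lean`) —
NO bearing on the Weil-sixfold content of `NonsplitSixfoldCells` is claimed.  Sequel (prime-level assembly to
the Hodge conjecture for `K_H(v)` modulo one open input; exact reach): `Theorems/KummerModuliPrimeLevelAssembly.lean`.
HONEST FRAMING: every theorem below is proved in the kernel FROM NAMED HYPOTHESES — the Literature facts
T1 `ModuliOfSheaves.Yoshioka2001_kummerFibre_restrictionImage` (Yoshioka 2001 §4.1 + Thm. 0.2 (2) + Prop. 4.20,
REFEREED ∕ shadow), T2 `ModuliOfSheaves.Markman2002_kunnethFactors_generate_cohomology_sheafModuli` (Markman 2002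
Cor. 2, REFEREED) and `ModuliOfSheaves.Bulles2020_sheafModuli_isDominatedByPowers_surface` (REFEREED).  Nothing
here asserts `HodgeConjecture`, `HC_AV`, `W₆`, `HC_Kum4Type`, `HC_KummerSheafModuliSpace` or the Hodge
conjecture for any single `K_H(v)`.

## What is proved (K = kernel; inputs named in each signature)

§1 GENERATION (T1 + T2).  `mem_cupSubalgebra_restrictedKunneth_of_forall_mem_invariants`: for a Kummer moduli
space `K = K_H(v)` presented as an Albanese fibre `j : K ↪ M = M_H(v)` (the clauses of
`ModuliOfSheaves.IsKummerSheafModuliSpace`, unbundled), EVERY class of the total cohomology `H*(K(ℂ); ℂ)` all of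
whose homogeneous components are `Γ(K)`-invariant lies in the sub-`ℂ`-algebra generated by the RESTRICTIONS
`j^*` of Markman's generators (the Künneth factors of `ch(ℰ)`, `ModuliOfSheaves.kunnethGenerators`).  In words:
**Markman's generation theorem, false verbatim for `K_H(v)` (Betti count:
`Hyperkaehler.Gottsche1994_bettiNumbers_generalizedKummerVariety`, barrier notes
`vhodge/BARRIER-NOTE-markman-diagonal-kummer.md`, `vhodge/lit-oqh/BARRIER-NOTE-twisted-diagonal-kummer.md`),
HOLDS ON THE `Γ(K)`-INVARIANT SUBRING.**  Proof: `H*(K)^{Γ} ⊆ Im j^*` degreewise (T1, kernel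
`….invariants_translationRep_le_range`), `j^*` on `H* = ⨁ Hᵏ` is the tree's `Hyperkaehler.totalPullback`,
multiplicative and unital (`totalPullback_totalCup`, `singularCohomology.map_one`), so `j^*(⟨G⟩) ⊆ ⟨j^* G⟩` by
minimality (`HilbertScheme.cupSubalgebra_le`), and `⟨G⟩ = H*(M)` is T2.  Bundled over the carrier with the
orientations supplied: `exists_presentation_cupSubalgebra_restrictedKunneth`.
§2 DOMINATION = "S5 ∕ LEMMA D" of the crux idea (T1 + Bülles).  `invariants_translationRep_le_dominatedClasses`:
every `Γ(K)`-invariant class of `Hᵏ(K_H(v)(ℂ); ℂ)` is carried by algebraic correspondences from the powers of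
`A` (`Summit.Ventures.HodgeKum4.dominatedClasses (2n) K 2 A k`): `Im j^*` of dominated classes is dominated
(`Summit.Ventures.HodgeKum4.map_mem_dominatedClasses`, ring 2's `IsAlgebraicCorrespondence.comp`) and `H*(M)`
is dominated (Bülles).  This is the `K_H(v)`-specific REPLACEMENT of route №1's (`route-Ventures-KummerFixedLocus`)
invariant-side cruxes L1 (LLV generation) ∧ L2′ (`J³`-domination): no LLV, no Kuga–Satake, no `L1` input.

## Inputs ledger of the crux idea, by name (T1–T5)

T1 = `Yoshioka2001_kummerFibre_restrictionImage` (typed by this seat; PRINT-SYNTHESIS flag on the transfer step,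
refereed clauses); T2 = `Markman2002_kunnethFactors_generate_cohomology_sheafModuli` (p524348); T3 = "LEMMA P"
(the involution `E ↦ (−1)^* E` acts by `(−1)ᵏ`; NOT needed here or in the sequel — it prices the clause
`φ(w) ≠ 1` of the Gram datum via the `G`-signature at `n = 4`, where the kum4 cell's
`kum4FixedFourfoldClasses_of_facts` takes it as the `∀`-hypothesis `hA5`; a per-variety form of that theorem
would turn the sequel's §3 at `n = 4` into "modulo print + F125X", not attempted); T4 = the `n`-indexed S1 ∕ S2
are Foster's fact BY NAME and S4 ∕ S5 are CONCLUSIONS spelled out (no new `def`); T5 = the sequel's `hI`.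

## What this is NOT

Not a proof of HC for any `K_H(v)`.  Not a statement about all `Kumⁿ`-type `X` (only the Kummer MODULI loci
carry `M_H(v)`).  Not Weil sixfolds.  No new definition, no new named fact in this file.
-/

noncomputable section

open CategoryTheory MonoidalCategory
open Literature.AlgebraicTopology.SingularHomology
open Literature.AlgebraicGeometry Literature.AlgebraicGeometry.HodgeTheory
  Literature.AlgebraicGeometry.Hyperkaehler Literature.AlgebraicGeometry.ModuliOfSheaves
open Literature.AlgebraicGeometry.Motives (SchemeOver AbelianVariety IsSmoothProjective ComplexPoints fiberOver
  fiberι)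
open Literature.AlgebraicGeometry.HilbertScheme (cupSubalgebra cupSubalgebra_le subset_cupSubalgebra
  one_mem_cupSubalgebra isCupClosed_cupSubalgebra)

-- `Summit.<Summit>.<Problem>` is the mandated summit-side namespace (CONVENTIONS §2); for the
-- single-conjunct summit `HodgeConjecture` the two coincide, so the duplicate is deliberate.
set_option linter.dupNamespace false

namespace Summit.HodgeConjecture.HodgeConjecture.Theorems.KummerModuliMarkmanOnM

variable {n : ℕ} {C : ChernCharacterBetti} {A : AbelianVariety ℂ} {p : complexBetti A.X (2 * 2)}
  {H : complexBetti A.X (2 * 1)} {v : (i : ℕ) → complexBetti A.X (2 * i)} {M : SchemeOver ℂ}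
  {E : (A.X ⊗ M).left.Modules} {T : AbelianVariety ℂ} {f : M ⟶ T.X} {t : ComplexPoints T.X} {K : SchemeOver ℂ}

/-! ### §0  Pull-back on the total cohomology carries generated subalgebras into generated subalgebras -/

/-- **`f^*⟨G⟩ ⊆ ⟨f^* G⟩`**: the pull-back on `H* = ⨁ₖ Hᵏ` along a continuous map is multiplicative and unital
(Hatcher Prop. 3.10), so the image of the subalgebra generated by `G` lies in the subalgebra generated by the
image of `G` (minimality of `cupSubalgebra`). [cite: Hatcher2002, §3.2 Prop. 3.10] [cite: LiQinWang2002, Def. 5.18 p. 13] -/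
theorem map_cupSubalgebra_le {Y Y' : Type} [TopologicalSpace Y] [TopologicalSpace Y'] (g : C(Y, Y'))
    (G : Set (totalCohomology ℂ Y')) :
    (cupSubalgebra ℂ Y' G).map (totalPullback ℂ g) ≤ cupSubalgebra ℂ Y (totalPullback ℂ g '' G) := by
  rw [Submodule.map_le_iff_le_comap]
  refine cupSubalgebra_le ?_ ?_ ?_
  · intro x hx
    rw [SetLike.mem_coe, Submodule.mem_comap]
    exact subset_cupSubalgebra (totalPullback ℂ g '' G) (Set.mem_image_of_mem _ hx)
  · rw [Submodule.mem_comap, totalPullback_lof, singularCohomology.map_one]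
    exact one_mem_cupSubalgebra _
  · intro x hx y hy
    rw [Submodule.mem_comap] at hx hy ⊢
    rw [totalPullback_totalCup]
    exact isCupClosed_cupSubalgebra _ _ hx _ hy

/-- **A total class all of whose components are restrictions is a restriction** (`H* = ⨁ₖ Hᵏ` and `j^*` acts
componentwise). [cite: Hatcher2002, §3.1 "Induced homomorphisms"] -/
theorem mem_range_totalPullback_of_forall {X' X : SchemeOver ℂ} (j : X' ⟶ X)
    {x : totalCohomology ℂ (ComplexPoints X')}
    (hx : ∀ k : ℕ, x k ∈ LinearMap.range (complexBetti.map j k).hom) :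
    x ∈ LinearMap.range (totalPullback ℂ (Motives.AlgPoints.mapContinuous (L := ℂ) j)) := by
  classical
  rw [← DirectSum.sum_support_of x]
  refine Submodule.sum_mem _ fun k _ ↦ ?_
  obtain ⟨u, hu⟩ := hx k
  refine ⟨ofDegree ℂ (ComplexPoints X) k u, ?_⟩
  rw [totalPullback_lof, ← DirectSum.lof_eq_of ℂ]
  exact congrArg (ofDegree ℂ (ComplexPoints X') k) hu

/-! ### §1  GENERATION: Markman's theorem holds for `K_H(v)` on the `Γ(K)`-invariant subring (T1 + T2) -/

/-- **The `Γ(K)`-INVARIANT subring of `H*(K_H(v)(ℂ); ℂ)` is generated by the restricted Künneth factors of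
`ch(ℰ)`.**  For `n ≥ 2`, a fine smooth projective `(2n+4)`-dimensional moduli space `(M, ℰ) = M_H(v)` of stable
sheaves on the abelian surface `A`, a Kummer moduli space `K ≅ f⁻¹(t) ↪ M` (smooth projective of dimension `2n`,
`Kumⁿ`-type; restriction `j = e.hom ≫ fiberι f t`) and `ℂ`-orientations `μ`, `ν` with Poincaré duality: every
`x ∈ H*(K(ℂ); ℂ)` whose degree-`k` component is `Γ(K)`-invariant for every `k` (`translationRep K k`, `Γ(K) =
autFixingH2H3 K`) lies in `cupSubalgebra ℂ K(ℂ) (j^* '' kunnethGenerators C A M ℰ μ ν)`.  Kernel, from T1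
(Yoshioka: `H*(K)^Γ ⊆ Im j^*`) and T2 (Markman 2002 Cor. 2 ON `M`: the Künneth factors generate `H*(M)`).  The
verbatim statement for ALL of `H*(K)` is false (module docstring); nothing is asserted about non-invariant classes.
[cite: Markman2002Generators, Cor. 2 (§2; arXiv:math/0009109 p. 3)]
[cite: Yoshioka2001AbelianSurfaces, §4.1 with Thm. 0.2 (2) and Prop. 4.20] -/
theorem mem_cupSubalgebra_restrictedKunneth_of_forall_mem_invariants
    (hY : Yoshioka2001_kummerFibre_restrictionImage)
    (hMk : Markman2002_kunnethFactors_generate_cohomology_sheafModuli) (hn : 2 ≤ n)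
    (hM : AbelianSurfaceSheafModuli C A p H v M E) (hMd : IsSmoothProjective (2 * n + 4) M)
    (e : K ≅ fiberOver f t) (hK : IsSmoothProjective (2 * n) K) (hKum : IsOfGeneralizedKummerType n K)
    (μ : HomologicalOrientation ℂ (ComplexPoints (M ⊗ A.X)) (2 * (2 * n + 4 + 2)))
    (ν : HomologicalOrientation ℂ (ComplexPoints M) (2 * (2 * n + 4))) (hμ : μ.HasPoincareDuality)
    (hν : ν.HasPoincareDuality) {x : totalCohomology ℂ (ComplexPoints K)}
    (hx : ∀ k : ℕ, x k ∈ (translationRep K k).invariants) :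
    x ∈ cupSubalgebra ℂ (ComplexPoints K)
      (totalPullback ℂ (Motives.AlgPoints.mapContinuous (L := ℂ) (e.hom ≫ fiberι f t)) ''
        kunnethGenerators C A.X M E μ ν) := by
  have hxr : x ∈ LinearMap.range
      (totalPullback ℂ (Motives.AlgPoints.mapContinuous (L := ℂ) (e.hom ≫ fiberι f t))) :=
    mem_range_totalPullback_of_forall (e.hom ≫ fiberι f t) fun k ↦
      hY.invariants_translationRep_le_range hn hM hMd e hK hKum k (hx k)
  obtain ⟨y, rfl⟩ := hxr
  refine map_cupSubalgebra_le _ _ ⟨y, ?_, rfl⟩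
  exact hMk.mem_of_abelianSurface hM hMd μ ν hμ hν y

/-- **Degreewise corollary: every `Γ(K)`-invariant homogeneous class of `K_H(v)` lies in the subalgebra generated
by the restricted Künneth factors** (the previous theorem for `x = ofDegree k c`).
[cite: Markman2002Generators, Cor. 2] [cite: Yoshioka2001AbelianSurfaces, §4.1 with Thm. 0.2 (2) and Prop. 4.20] -/
theorem ofDegree_mem_cupSubalgebra_restrictedKunneth_of_mem_invariants
    (hY : Yoshioka2001_kummerFibre_restrictionImage)
    (hMk : Markman2002_kunnethFactors_generate_cohomology_sheafModuli) (hn : 2 ≤ n)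
    (hM : AbelianSurfaceSheafModuli C A p H v M E) (hMd : IsSmoothProjective (2 * n + 4) M)
    (e : K ≅ fiberOver f t) (hK : IsSmoothProjective (2 * n) K) (hKum : IsOfGeneralizedKummerType n K)
    (μ : HomologicalOrientation ℂ (ComplexPoints (M ⊗ A.X)) (2 * (2 * n + 4 + 2)))
    (ν : HomologicalOrientation ℂ (ComplexPoints M) (2 * (2 * n + 4))) (hμ : μ.HasPoincareDuality)
    (hν : ν.HasPoincareDuality) {k : ℕ} {c : complexBetti K k} (hc : c ∈ (translationRep K k).invariants) :
    ofDegree ℂ (ComplexPoints K) k c ∈ cupSubalgebra ℂ (ComplexPoints K)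
      (totalPullback ℂ (Motives.AlgPoints.mapContinuous (L := ℂ) (e.hom ≫ fiberι f t)) ''
        kunnethGenerators C A.X M E μ ν) := by
  classical
  refine mem_cupSubalgebra_restrictedKunneth_of_forall_mem_invariants hY hMk hn hM hMd e hK hKum μ ν hμ hν
    fun k' ↦ ?_
  by_cases hk : k' = k
  · subst hk
    rw [DirectSum.lof_apply]
    exact hc
  · rw [DirectSum.lof_eq_of, DirectSum.of_eq_of_ne _ _ _ hk]
    exact Submodule.zero_mem _

/-- **GENERATION, bundled over the carrier (orientations supplied): every Kummer moduli space `K_H(v)` of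
`Kumⁿ`-type (`n ≥ 2`, `IsKummerSheafModuliSpace n A K`) admits a fine moduli space `(M, ℰ) = M_H(v)` on `A`, a
morphism `j : K ⟶ M` and `ℂ`-orientations with Poincaré duality such that the `Γ(K)`-invariant subring of
`H*(K(ℂ); ℂ)` lies in the subalgebra generated by `j^*` of the Künneth factors of `ch(ℰ)`** (the complex
orientations of an `OrientationFamily`; Poincaré duality by `OrientationFamily.hasPoincareDuality`).
[cite: Markman2002Generators, Cor. 2] [cite: Yoshioka2001AbelianSurfaces, §4.1 with Thm. 0.2 (2) and Prop. 4.20] -/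
theorem exists_presentation_cupSubalgebra_restrictedKunneth (hY : Yoshioka2001_kummerFibre_restrictionImage)
    (hMk : Markman2002_kunnethFactors_generate_cohomology_sheafModuli) (hn : 2 ≤ n)
    (hKv : IsKummerSheafModuliSpace n A K) :
    ∃ (C : ChernCharacterBetti) (p : complexBetti A.X (2 * 2)) (H : complexBetti A.X (2 * 1))
      (v : (i : ℕ) → complexBetti A.X (2 * i)) (M : SchemeOver ℂ) (E : (A.X ⊗ M).left.Modules) (j : K ⟶ M)
      (μ : HomologicalOrientation ℂ (ComplexPoints (M ⊗ A.X)) (2 * (2 * n + 4 + 2)))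
      (ν : HomologicalOrientation ℂ (ComplexPoints M) (2 * (2 * n + 4))),
      AbelianSurfaceSheafModuli C A p H v M E ∧ IsSmoothProjective (2 * n + 4) M ∧ μ.HasPoincareDuality ∧
        ν.HasPoincareDuality ∧
        ∀ x : totalCohomology ℂ (ComplexPoints K), (∀ k : ℕ, x k ∈ (translationRep K k).invariants) →
          x ∈ cupSubalgebra ℂ (ComplexPoints K)
            (totalPullback ℂ (Motives.AlgPoints.mapContinuous (L := ℂ) j) '' kunnethGenerators C A.X M E μ ν) := by
  obtain ⟨⟨C, p, H, v, M, E, hM, hMd, T, f, t, ⟨e⟩⟩, hK, hKum⟩ := hKv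
  obtain ⟨μ, hμ⟩ : ∃ μ : OrientationFamily, μ.HasPoincareDuality :=
    ⟨fun _ _ h ↦ Classical.choice (Motives.ComplexPoints.isOrientableOver ℂ h),
      OrientationFamily.hasPoincareDuality _⟩
  have hMA : IsSmoothProjective (2 * n + 4 + 2) (M ⊗ A.X) :=
    IsSmoothProjective.tensor_holds hMd hM.isSmoothProjective_surface
  exact ⟨C, p, H, v, M, E, e.hom ≫ fiberι f t, μ hMA, μ hMd, hM, hMd, hμ hMA, hμ hMd, fun x hx ↦
    mem_cupSubalgebra_restrictedKunneth_of_forall_mem_invariants hY hMk hn hM hMd e hK hKum _ _ (hμ hMA)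
      (hμ hMd) hx⟩

/-! ### §2  DOMINATION ("S5" ∕ LEMMA D): the invariant classes of `K_H(v)` come from the powers of `A` (T1 + Bülles) -/

/-- **Restriction carries the domination of `M_H(v)` to its image**: for a fine smooth projective
`(2n+4)`-dimensional `M = M_H(v)` on the abelian surface `A` and ANY morphism `j : K ⟶ M` from a smooth projective
`2n`-fold, `j^*(Hᵏ(M(ℂ); ℂ)) ⊆ dominatedClasses (2n) K 2 A k` (Bülles: `H*(M)` is dominated by the powers of `A`;
pull-back composes algebraic correspondences).  Kernel, modulo Bülles' record.
[cite: Bulles2020, Thm. 0.1 (arXiv:1806.08284 Thm. 1)] [cite: Fulton1998, §16.1 Prop. 16.1.1] -/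
theorem range_map_le_dominatedClasses (hB : Bulles2020_sheafModuli_isDominatedByPowers_surface)
    (hM : AbelianSurfaceSheafModuli C A p H v M E) (hMd : IsSmoothProjective (2 * n + 4) M)
    (hK : IsSmoothProjective (2 * n) K) (j : K ⟶ M) (k : ℕ) :
    LinearMap.range (complexBetti.map j k).hom ≤ Summit.Ventures.HodgeKum4.dominatedClasses (2 * n) K 2 A.X k := by
  rintro _ ⟨u, rfl⟩
  have hAX : IsSmoothProjective 2 A.X := hM.isSmoothProjective_surface
  have hu : u ∈ Summit.Ventures.HodgeKum4.dominatedClasses (2 * n + 4) M 2 A.X k := by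
    have htop : Summit.Ventures.HodgeKum4.dominatedClasses (2 * n + 4) M 2 A.X k = ⊤ := (hB.abelianSurface hM hMd) k
    rw [htop]
    exact Submodule.mem_top
  by_cases hk : k ≤ 2 * (2 * n)
  · exact Summit.Ventures.HodgeKum4.map_mem_dominatedClasses hMd hK hAX j hk hu
  · haveI := subsingleton_complexBetti hK (not_le.1 hk)
    rw [Subsingleton.elim ((complexBetti.map j k).hom u) 0]
    exact Submodule.zero_mem _

/-- **DOMINATION OF THE INVARIANT HALF ("S5"), per presentation: every `Γ(K)`-invariant class of the Kummer moduli
space `K_H(v) ↪ M_H(v)` is carried by algebraic correspondences from the powers of the abelian surface `A`.**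
Kernel, from T1 (`H*(K)^Γ ⊆ Im j^*`) and Bülles (`Im j^*` dominated).
[cite: Yoshioka2001AbelianSurfaces, §4.1 with Thm. 0.2 (2) and Prop. 4.20] [cite: Bulles2020, Thm. 0.1] -/
theorem invariants_translationRep_le_dominatedClasses_of_presentation
    (hY : Yoshioka2001_kummerFibre_restrictionImage) (hB : Bulles2020_sheafModuli_isDominatedByPowers_surface)
    (hn : 2 ≤ n) (hM : AbelianSurfaceSheafModuli C A p H v M E) (hMd : IsSmoothProjective (2 * n + 4) M)
    (e : K ≅ fiberOver f t) (hK : IsSmoothProjective (2 * n) K) (hKum : IsOfGeneralizedKummerType n K) (k : ℕ) :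
    (translationRep K k).invariants ≤ Summit.Ventures.HodgeKum4.dominatedClasses (2 * n) K 2 A.X k :=
  (hY.invariants_translationRep_le_range hn hM hMd e hK hKum k).trans
    (range_map_le_dominatedClasses hB hM hMd hK (e.hom ≫ fiberι f t) k)

/-- **DOMINATION OF THE INVARIANT HALF ("S5" of the crux idea; `KummerSheafModuliInvariantsDominated n` of the
vhodge-oqh-3 memos), over the carrier: for `n ≥ 2` and every Kummer moduli space `K_H(v)` of `Kumⁿ`-type on `A`
(`IsKummerSheafModuliSpace n A K`), `Hᵏ(K(ℂ); ℂ)^{Γ(K)} ⊆ dominatedClasses (2n) K 2 A k` for every `k`.**  Kernel,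
from T1 + Bülles; this is the half of `Theorems.KummerSheafModuliSpace_dominatedByAbelianSurface` that route №1
(`route-Ventures-KummerFixedLocus`) obtains on a general `Kum⁴`-type `X` only through L1 ∧ L2′.
[cite: Yoshioka2001AbelianSurfaces, §4.1 with Thm. 0.2 (2) and Prop. 4.20] [cite: Bulles2020, Thm. 0.1]
[cite: Floccari2023OG6Motive, §1 (arXiv:2203.16257 p. 2: the question for K_v(A,H))] -/
theorem invariants_translationRep_le_dominatedClasses (hY : Yoshioka2001_kummerFibre_restrictionImage)
    (hB : Bulles2020_sheafModuli_isDominatedByPowers_surface) (hn : 2 ≤ n) (hKv : IsKummerSheafModuliSpace n A K)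
    (k : ℕ) : (translationRep K k).invariants ≤ Summit.Ventures.HodgeKum4.dominatedClasses (2 * n) K 2 A.X k := by
  obtain ⟨C, p, H, v, M, E, j, hM, hMd, hinv, -, -, -⟩ := hY.exists_presentation hn hKv
  exact (hinv k).trans (range_map_le_dominatedClasses hB hM hMd hKv.isSmoothProjective j k)

/-- **The same in the kum4 cell's degreewise vocabulary `IsGammaInvariant`** (its `autFixingH2H3` has the same
body as the Literature one): a `Γ(K)`-invariant class `c ∈ Hᵏ(K_H(v)(ℂ); ℂ)` is dominated by the powers of `A`.
[cite: Yoshioka2001AbelianSurfaces, §4.1 with Thm. 0.2 (2) and Prop. 4.20] [cite: Bulles2020, Thm. 0.1] -/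
theorem mem_dominatedClasses_of_isGammaInvariant (hY : Yoshioka2001_kummerFibre_restrictionImage)
    (hB : Bulles2020_sheafModuli_isDominatedByPowers_surface) (hn : 2 ≤ n) (hKv : IsKummerSheafModuliSpace n A K)
    {k : ℕ} {c : complexBetti K k} (hc : Summit.Ventures.HodgeKum4.IsGammaInvariant K c) :
    c ∈ Summit.Ventures.HodgeKum4.dominatedClasses (2 * n) K 2 A.X k := by
  obtain ⟨C, p, H, v, M, E, j, hM, hMd, -, hfix, -, -⟩ := hY.exists_presentation hn hKv
  exact range_map_le_dominatedClasses hB hM hMd hKv.isSmoothProjective j k (hfix k c fun g hg ↦ hc g hg)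

end Summit.HodgeConjecture.HodgeConjecture.Theorems.KummerModuliMarkmanOnM

end
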